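import Summits.ValiantsHypothesis.ValiantsHypothesis.Theorems.BarrierLeverAnchoredDoorHitsLowerPairsStarLabelling

/-!
# Route BarrierLever — support item `AnchoredDoorHitsLowerPairs` (stmt-ValiantsHypothesis-22510), line `anchored_peeling`:
# THE ONE-CENTRE DEGENERATION OF THE STAR-FOREST MATRIX (uniform scaling)

Helper file (`--supports stmt-ValiantsHypothesis-22510`; val-np-p1 g34). Door slot of record: `Stmt.conjStarLower`
(…StarDoor). Closes NO item; nothing here bears on crux 14610 or on `VP ≠ VNP`, which is NOT proved.

THE DEVICE. Scale ALL edge weights uniformly: `g b e = ḡ b e · X`, `d b e = d̄ b e · X`. The `(A', S')`-summand of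
`starEntry g d A S` (row centres `A'`, column centres `S'`) is then the monomial `scCoef · X^{#leaves}`, `#leaves = |A ∖ A'| + |S ∖ S'|`
(`starTerm_sc`). A nonzero summand with `A ≠ ∅` has at least one centre, so its degree is at most the POTENTIAL
`scPot A S = (|A| - 1) + |S|` (`natDegree_starEntry_sc_le`; for `A = ∅` the entry is the constant `[every column vertex is an
isolated centre]`), and the `X^{scPot}`-coefficient is the ONE-CENTRE MATRIX `oneTop ḡ d̄ A S` (`coeff_starEntry_sc`): the sum of the
weights of the star forests with exactly one centre. Its entries (§3): `oneTop ∅ S = [S = ∅]`; on a row VERTEX `{b}`: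
`oneTop {b} {e} = d̄ b e + ḡ b e` (the edge, either orientation) and `oneTop {b} S = ∏_{e ∈ S} d̄ b e` for `|S| ≥ 2` (the star centred
at `b`); on a row FACE `A`, `|A| ≥ 2`: `oneTop A {e} = ∏_{b ∈ A} ḡ b e` (the star centred at `e`) and `oneTop A S = 0` for `|S| ≠ 1`
(two faces of size `≥ 2` need two centres). THE PRINCIPLE (`starDet_ne_zero_of_oneTop`, pattern of …StarLabelling): if the
one-centre matrix of a pair of families is nonsingular for SOME complex `ḡ, d̄`, some complex weights make the star-forest block
nonsingular (rescale rows by `X^{Ka - a_i}`, columns by `X^{Kc - c_j}`, Literature `coeff_det_of_natDegree_le`, a nonzero polynomial has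
a non-root). No lower-set or injectivity hypothesis. The companion file …StarVertexRich makes the one-centre matrix nonsingular on
every VERTEX-RICH injective lower pair (`f₀(I) + f₀(J) + 1 ≥ r`).
-/

set_option linter.dupNamespace false

namespace Summit.ValiantsHypothesis.ValiantsHypothesis.Theorems.BarrierLever.AnchoredPeeling

open Finset Polynomial

noncomputable section

namespace StarDoor

variable {K : Type*} [CommRing K] {h : ℕ}

/-! ## 1. The summands, the potential and the one-centre matrix -/

section Defs

variable (gb db : Fin h → Fin h → K)

/-- Coefficient of the `(A', S')`-summand of `starEntry` (`A'` = row centres, `S'` = column centres): every row leaf chooses a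
column centre, every column leaf a row centre. -/
def scCoef (A S A' S' : Finset (Fin h)) : K :=
  (∏ b ∈ A \ A', ∑ e ∈ S', gb b e) * ∏ e ∈ S \ S', ∑ b ∈ A', db b e

/-- Degree of the `(A', S')`-summand on the uniform scaling family: the number of leaves. -/
def scDeg (A S A' S' : Finset (Fin h)) : ℕ := (A \ A').card + (S \ S').card

/-- The POTENTIAL of a (row set, column set): `(|A| - 1) + |S|` (natural subtraction, so `|S|` for `A = ∅`). -/
def scPot (A S : Finset (Fin h)) : ℕ := (A.card - 1) + S.card

/-- **The one-centre matrix entry** `oneTop ḡ d̄ A S`: the `X^{scPot A S}`-coefficient of `starEntry` on the uniform scaling family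
(`coeff_starEntry_sc`), DEFINED as the sum of the coefficients of the summands of top degree. -/
def oneTop (A S : Finset (Fin h)) : K :=
  ∑ A' ∈ A.powerset, ∑ S' ∈ S.powerset, if scDeg A S A' S' = scPot A S then scCoef gb db A S A' S' else 0

/-- Ring homomorphisms pass through `oneTop`. -/
theorem map_oneTop {L : Type*} [CommRing L] (f : K →+* L) (A S : Finset (Fin h)) :
    f (oneTop gb db A S) = oneTop (fun b e => f (gb b e)) (fun b e => f (db b e)) A S := by
  unfold oneTop scCoef
  simp only [map_sum, apply_ite f, map_zero, map_mul, map_prod]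

/-- A summand with a row leaf but no column centre vanishes. -/
theorem scCoef_eq_zero_of_row {A S A' S' : Finset (Fin h)} (hne : (A \ A').Nonempty) (hS' : S' = ∅) :
    scCoef gb db A S A' S' = 0 := by
  obtain ⟨b, hb⟩ := hne
  unfold scCoef
  rw [Finset.prod_eq_zero hb (by rw [hS', Finset.sum_empty]), zero_mul]

/-- A summand with a column leaf but no row centre vanishes. -/
theorem scCoef_eq_zero_of_col {A S A' S' : Finset (Fin h)} (hne : (S \ S').Nonempty) (hA' : A' = ∅) :
    scCoef gb db A S A' S' = 0 := by
  obtain ⟨e, he⟩ := hne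
  unfold scCoef
  rw [Finset.prod_eq_zero he (by rw [hA', Finset.sum_empty]), mul_zero]

/-- **Degree bound for a nonzero summand:** `#leaves ≤ scPot`. -/
theorem scDeg_le_scPot {A S A' S' : Finset (Fin h)} (hA' : A' ⊆ A) (hS' : S' ⊆ S)
    (hc : scCoef gb db A S A' S' ≠ 0) : scDeg A S A' S' ≤ scPot A S := by
  unfold scDeg scPot
  rw [Finset.card_sdiff_of_subset hA', Finset.card_sdiff_of_subset hS']
  have hA'le : A'.card ≤ A.card := Finset.card_le_card hA'
  have hS'le : S'.card ≤ S.card := Finset.card_le_card hS'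
  by_cases hA : A = ∅
  · subst hA
    have : A' = ∅ := Finset.subset_empty.mp hA'
    subst this
    simp
  · -- some centre exists
    have hsum : 1 ≤ A'.card + S'.card := by
      by_contra hlt
      push Not at hlt
      have hA'0 : A' = ∅ := Finset.card_eq_zero.mp (by omega)
      have hS'0 : S' = ∅ := Finset.card_eq_zero.mp (by omega)
      apply hc
      refine scCoef_eq_zero_of_row gb db ?_ hS'0
      rw [hA'0, Finset.sdiff_empty]
      exact Finset.nonempty_iff_ne_empty.mpr hA
    have hApos : 1 ≤ A.card := Finset.card_pos.mpr (Finset.nonempty_iff_ne_empty.mpr hA)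
    omega

end Defs

/-! ## 2. The uniform scaling family: summands are monomials, degree bound, top coefficient -/

section Family

variable (gb db : Fin h → Fin h → ℂ)

/-- Row-leaf weights of the uniform scaling family: `ḡ b e · X`. -/
def gSc (b e : Fin h) : ℂ[X] := C (gb b e) * X

/-- Column-leaf weights of the uniform scaling family: `d̄ b e · X`. -/
def dSc (b e : Fin h) : ℂ[X] := C (db b e) * X

/-- A product of `(C c_i) · X` over a finset is `C (∏ c_i) · X ^ card`. -/
theorem prod_C_mul_X {ι : Type*} (s : Finset ι) (c : ι → ℂ) :
    ∏ i ∈ s, (C (c i) * (X : ℂ[X])) = C (∏ i ∈ s, c i) * X ^ s.card := by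
  rw [Finset.prod_mul_distrib, Finset.prod_const, map_prod]

/-- **The `(A', S')`-summand on the family is the monomial `scCoef · X^{scDeg}`.** -/
theorem starTerm_sc (A S A' S' : Finset (Fin h)) :
    (∏ b ∈ A \ A', ∑ e ∈ S', gSc gb b e) * (∏ e ∈ S \ S', ∑ b ∈ A', dSc db b e)
      = C (scCoef gb db A S A' S') * X ^ (scDeg A S A' S') := by
  unfold gSc dSc scCoef scDeg
  have h1 : ∀ b, ∑ e ∈ S', C (gb b e) * (X : ℂ[X]) = C (∑ e ∈ S', gb b e) * X := fun b => by
    rw [← Finset.sum_mul, map_sum]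
  have h2 : ∀ e, ∑ b ∈ A', C (db b e) * (X : ℂ[X]) = C (∑ b ∈ A', db b e) * X := fun e => by
    rw [← Finset.sum_mul, map_sum]
  simp_rw [h1, h2]
  rw [prod_C_mul_X, prod_C_mul_X, map_mul, pow_add]
  ring

/-- `starEntry` on the family is the sum of these monomials. -/
theorem starEntry_sc_eq (A S : Finset (Fin h)) :
    starEntry (gSc gb) (dSc db) A S
      = ∑ A' ∈ A.powerset, ∑ S' ∈ S.powerset, C (scCoef gb db A S A' S') * X ^ (scDeg A S A' S') := by
  unfold starEntry
  exact Finset.sum_congr rfl fun A' _ => Finset.sum_congr rfl fun S' _ => starTerm_sc gb db A S A' S'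

/-- **Degree bound:** `starEntry` on the family has degree at most the potential. -/
theorem natDegree_starEntry_sc_le (A S : Finset (Fin h)) :
    (starEntry (gSc gb) (dSc db) A S).natDegree ≤ scPot A S := by
  classical
  rw [starEntry_sc_eq]
  refine natDegree_sum_le_of_forall_le _ _ fun A' hA' => natDegree_sum_le_of_forall_le _ _ fun S' hS' => ?_
  by_cases hc : scCoef gb db A S A' S' = 0
  · rw [hc, map_zero, zero_mul, natDegree_zero]; exact Nat.zero_le _
  · exact (natDegree_C_mul_X_pow_le _ _).trans
      (scDeg_le_scPot gb db (Finset.mem_powerset.mp hA') (Finset.mem_powerset.mp hS') hc)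

/-- **Top coefficient:** the `X^{scPot A S}`-coefficient of `starEntry` on the family is `oneTop ḡ d̄ A S`. -/
theorem coeff_starEntry_sc (A S : Finset (Fin h)) :
    (starEntry (gSc gb) (dSc db) A S).coeff (scPot A S) = oneTop gb db A S := by
  classical
  rw [starEntry_sc_eq, finsetSum_coeff]
  unfold oneTop
  refine Finset.sum_congr rfl fun A' _ => ?_
  rw [finsetSum_coeff]
  refine Finset.sum_congr rfl fun S' _ => ?_
  rw [coeff_C_mul_X_pow]
  by_cases hdeg : scDeg A S A' S' = scPot A S
  · rw [if_pos hdeg.symm, if_pos hdeg]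
  · rw [if_neg (fun h' => hdeg h'.symm), if_neg hdeg]

end Family

/-- Sums over the subsets of a singleton. -/
theorem sum_powerset_singleton' {ι M : Type*} [DecidableEq ι] [AddCommMonoid M] (f : Finset ι → M) (a : ι) :
    ∑ t ∈ ({a} : Finset ι).powerset, f t = f ∅ + f {a} := by
  rw [← LawfulSingleton.insert_empty_eq, Finset.sum_powerset_insert (Finset.notMem_empty a), Finset.powerset_empty,
    Finset.sum_singleton, Finset.sum_singleton]

/-! ## 3. The entries of the one-centre matrix -/

section Entries

variable (gb db : Fin h → Fin h → K)

/-- The empty row: `oneTop ∅ S = [S = ∅]` (all column vertices would have to be isolated centres). -/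
theorem oneTop_empty_left (S : Finset (Fin h)) : oneTop gb db ∅ S = if S = ∅ then 1 else 0 := by
  classical
  unfold oneTop
  rw [Finset.powerset_empty, Finset.sum_singleton]
  by_cases hS : S = ∅
  · subst hS
    rw [Finset.powerset_empty, Finset.sum_singleton, if_pos rfl]
    simp [scDeg, scPot, scCoef]
  · rw [if_neg hS]
    refine Finset.sum_eq_zero fun S' hS' => ?_
    split_ifs with hdeg
    · refine scCoef_eq_zero_of_col gb db ?_ rfl
      have hdeg' : (S \ S').card = S.card := by simpa [scDeg, scPot] using hdeg
      rw [← Finset.card_pos, hdeg', Finset.card_pos]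
      exact Finset.nonempty_iff_ne_empty.mpr hS
    · rfl

/-- Two faces of size `≥ 2` (or a face of size `≥ 2` against the empty column): no one-centre forest. -/
theorem oneTop_eq_zero_of_two_le {A S : Finset (Fin h)} (hA : 2 ≤ A.card) (hS : S.card ≠ 1) :
    oneTop gb db A S = 0 := by
  classical
  unfold oneTop
  refine Finset.sum_eq_zero fun A' hA' => Finset.sum_eq_zero fun S' hS' => ?_
  have hA'A : A' ⊆ A := Finset.mem_powerset.mp hA'
  have hS'S : S' ⊆ S := Finset.mem_powerset.mp hS'
  split_ifs with hdeg
  · unfold scDeg scPot at hdeg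
    rw [Finset.card_sdiff_of_subset hA'A, Finset.card_sdiff_of_subset hS'S] at hdeg
    have hA'le : A'.card ≤ A.card := Finset.card_le_card hA'A
    have hS'le : S'.card ≤ S.card := Finset.card_le_card hS'S
    have hone : A'.card + S'.card = 1 := by omega
    by_cases hA'0 : A'.card = 0
    · -- the column centre is alone: some column leaf has no row centre
      refine scCoef_eq_zero_of_col gb db ?_ (Finset.card_eq_zero.mp hA'0)
      rw [← Finset.card_pos, Finset.card_sdiff_of_subset hS'S]
      omega
    · -- the row centre is alone: some row leaf has no column centre
      refine scCoef_eq_zero_of_row gb db ?_ (Finset.card_eq_zero.mp (by omega))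
      rw [← Finset.card_pos, Finset.card_sdiff_of_subset hA'A]
      omega
  · rfl

/-- A row vertex against a column vertex: the edge, in either orientation. -/
theorem oneTop_singleton_singleton (b e : Fin h) : oneTop gb db {b} {e} = db b e + gb b e := by
  classical
  unfold oneTop
  rw [sum_powerset_singleton', sum_powerset_singleton', sum_powerset_singleton']
  simp [scDeg, scPot, scCoef]
  ring

/-- A row vertex against a column face of size `≥ 2`: the star centred at the row vertex. -/
theorem oneTop_singleton_left {b : Fin h} {S : Finset (Fin h)} (hS : 2 ≤ S.card) :
    oneTop gb db {b} S = ∏ e ∈ S, db b e := by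
  classical
  unfold oneTop
  rw [sum_powerset_singleton']
  have hpot : scPot ({b} : Finset (Fin h)) S = S.card := by simp [scPot]
  -- the row vertex as a leaf: every such summand vanishes
  have h0 : ∑ S' ∈ S.powerset, (if scDeg {b} S ∅ S' = scPot {b} S then scCoef gb db {b} S ∅ S' else 0) = 0 := by
    refine Finset.sum_eq_zero fun S' hS' => ?_
    have hS'S : S' ⊆ S := Finset.mem_powerset.mp hS'
    split_ifs with hdeg
    · refine scCoef_eq_zero_of_col gb db ?_ rfl
      unfold scDeg at hdeg
      rw [hpot, Finset.sdiff_empty, Finset.card_singleton, Finset.card_sdiff_of_subset hS'S] at hdeg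
      have hS'le : S'.card ≤ S.card := Finset.card_le_card hS'S
      rw [← Finset.card_pos, Finset.card_sdiff_of_subset hS'S]
      omega
    · rfl
  -- the row vertex as the centre: only `S' = ∅` reaches the top degree
  have h1 : ∑ S' ∈ S.powerset, (if scDeg {b} S {b} S' = scPot {b} S then scCoef gb db {b} S {b} S' else 0)
      = ∏ e ∈ S, db b e := by
    rw [Finset.sum_eq_single ∅]
    · rw [if_pos (by simp [scDeg, hpot])]
      simp [scCoef]
    · intro S' hS' hne
      have hS'S : S' ⊆ S := Finset.mem_powerset.mp hS'
      rw [if_neg]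
      unfold scDeg
      rw [hpot, Finset.sdiff_self, Finset.card_empty, zero_add, Finset.card_sdiff_of_subset hS'S]
      have hpos : 0 < S'.card := Finset.card_pos.mpr (Finset.nonempty_iff_ne_empty.mpr hne)
      have hS'le : S'.card ≤ S.card := Finset.card_le_card hS'S
      omega
    · intro h'; exact absurd (Finset.empty_mem_powerset S) h'
  rw [h0, h1, zero_add]

/-- A row face of size `≥ 2` against a column vertex: the star centred at the column vertex. -/
theorem oneTop_singleton_right {A : Finset (Fin h)} (hA : 2 ≤ A.card) (e : Fin h) :
    oneTop gb db A {e} = ∏ b ∈ A, gb b e := by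
  classical
  unfold oneTop
  rw [Finset.sum_comm, sum_powerset_singleton']
  have hpot : scPot A ({e} : Finset (Fin h)) = A.card := by
    unfold scPot; rw [Finset.card_singleton]; omega
  -- the column vertex as a leaf: every such summand vanishes
  have h0 : ∑ A' ∈ A.powerset, (if scDeg A {e} A' ∅ = scPot A {e} then scCoef gb db A {e} A' ∅ else 0) = 0 := by
    refine Finset.sum_eq_zero fun A' hA' => ?_
    have hA'A : A' ⊆ A := Finset.mem_powerset.mp hA'
    split_ifs with hdeg
    · refine scCoef_eq_zero_of_row gb db ?_ rfl
      unfold scDeg at hdeg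
      rw [hpot, Finset.sdiff_empty, Finset.card_singleton, Finset.card_sdiff_of_subset hA'A] at hdeg
      have hA'le : A'.card ≤ A.card := Finset.card_le_card hA'A
      rw [← Finset.card_pos, Finset.card_sdiff_of_subset hA'A]
      omega
    · rfl
  -- the column vertex as the centre: only `A' = ∅` reaches the top degree
  have h1 : ∑ A' ∈ A.powerset, (if scDeg A {e} A' {e} = scPot A {e} then scCoef gb db A {e} A' {e} else 0)
      = ∏ b ∈ A, gb b e := by
    rw [Finset.sum_eq_single ∅]
    · rw [if_pos (by simp [scDeg, hpot])]
      simp [scCoef]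
    · intro A' hA' hne
      have hA'A : A' ⊆ A := Finset.mem_powerset.mp hA'
      rw [if_neg]
      unfold scDeg
      rw [hpot, Finset.sdiff_self, Finset.card_empty, add_zero, Finset.card_sdiff_of_subset hA'A]
      have hpos : 0 < A'.card := Finset.card_pos.mpr (Finset.nonempty_iff_ne_empty.mpr hne)
      have hA'le : A'.card ≤ A.card := Finset.card_le_card hA'A
      omega
    · intro h'; exact absurd (Finset.empty_mem_powerset A) h'
  rw [h0, h1, zero_add]

end Entries

/-! ## 4. The one-centre principle -/

section Principle

variable {r : ℕ} (u w : Fin r → Finset (Fin h)) (gb db : Fin h → Fin h → ℂ)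

/-- **THE ONE-CENTRE PRINCIPLE.** For ANY row and column families `u w` (no lower-set, no injectivity hypothesis) and ANY complex
`ḡ, d̄`: if the one-centre matrix `(oneTop ḡ d̄ (u i) (w j))_{i j}` is nonsingular, then some complex weights make the star-forest block
`(starEntry g d (u i) (w j))` nonsingular. -/
theorem starDet_ne_zero_of_oneTop
    (hN : (Matrix.of fun i j : Fin r => oneTop gb db (u i) (w j)).det ≠ 0) :
    ∃ g d : Fin h → Fin h → ℂ, (Matrix.of fun i j : Fin r => starEntry g d (u i) (w j)).det ≠ 0 := by
  classical
  -- the block on the family, and its rescaling to uniform degree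
  let a : Fin r → ℕ := fun i => (u i).card - 1
  let c : Fin r → ℕ := fun j => (w j).card
  let Ka : ℕ := ∑ i, a i
  let Kc : ℕ := ∑ j, c j
  have ha : ∀ i, a i ≤ Ka := fun i => Finset.single_le_sum (f := a) (fun i _ => Nat.zero_le _) (Finset.mem_univ i)
  have hc : ∀ j, c j ≤ Kc := fun j => Finset.single_le_sum (f := c) (fun j _ => Nat.zero_le _) (Finset.mem_univ j)
  have hpot : ∀ i j, scPot (u i) (w j) = a i + c j := fun i j => rfl
  let MP : Matrix (Fin r) (Fin r) ℂ[X] := Matrix.of fun i j => starEntry (gSc gb) (dSc db) (u i) (w j)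
  let MS : Matrix (Fin r) (Fin r) ℂ[X] := Matrix.of fun i j => X ^ (Ka - a i) * MP i j * X ^ (Kc - c j)
  have hdeg : ∀ i j, (MS i j).natDegree ≤ Ka + Kc := by
    intro i j
    simp only [MS, MP, Matrix.of_apply]
    have h1 : (starEntry (gSc gb) (dSc db) (u i) (w j)).natDegree ≤ a i + c j := by
      rw [← hpot]; exact natDegree_starEntry_sc_le gb db (u i) (w j)
    calc (X ^ (Ka - a i) * starEntry (gSc gb) (dSc db) (u i) (w j) * X ^ (Kc - c j)).natDegree
        ≤ (X ^ (Ka - a i) * starEntry (gSc gb) (dSc db) (u i) (w j)).natDegree + (X ^ (Kc - c j) : ℂ[X]).natDegree :=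
          natDegree_mul_le
      _ ≤ ((X ^ (Ka - a i) : ℂ[X]).natDegree + (starEntry (gSc gb) (dSc db) (u i) (w j)).natDegree)
            + (X ^ (Kc - c j) : ℂ[X]).natDegree :=
          Nat.add_le_add_right natDegree_mul_le _
      _ ≤ ((Ka - a i) + (a i + c j)) + (Kc - c j) := by
          gcongr
          · exact natDegree_X_pow_le _
          · exact natDegree_X_pow_le _
      _ = Ka + Kc := by have := ha i; have := hc j; omega
  have hcoefMS : (MS.map fun p => p.coeff (Ka + Kc)) = Matrix.of fun i j : Fin r => oneTop gb db (u i) (w j) := by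
    ext i j
    simp only [MS, MP, Matrix.map_apply, Matrix.of_apply]
    have hK : Ka + Kc = ((a i + c j) + (Ka - a i)) + (Kc - c j) := by have := ha i; have := hc j; omega
    rw [hK, coeff_mul_X_pow, coeff_X_pow_mul, ← hpot, coeff_starEntry_sc]
  -- the top coefficient of `det MS` is `det oneTop ≠ 0`
  have hcoef : (MS.det).coeff (Fintype.card (Fin r) * (Ka + Kc)) = (Matrix.of fun i j : Fin r => oneTop gb db (u i) (w j)).det := by
    rw [Literature.AlgebraicGeometry.DeterminantalHypersurfaces.coeff_det_of_natDegree_le MS (Ka + Kc) hdeg, hcoefMS]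
  have hMS : MS.det ≠ 0 := by
    intro h0
    apply hN
    rw [← hcoef, h0, coeff_zero]
  have hMSeq : MS = Matrix.diagonal (fun i => (X : ℂ[X]) ^ (Ka - a i)) * MP * Matrix.diagonal (fun j => (X : ℂ[X]) ^ (Kc - c j)) := by
    ext i j
    simp only [MS, Matrix.of_apply, Matrix.mul_diagonal, Matrix.diagonal_mul]
  have hMP : MP.det ≠ 0 := by
    intro h0
    apply hMS
    rw [hMSeq, Matrix.det_mul, Matrix.det_mul, h0, mul_zero, zero_mul]
  -- a nonzero complex polynomial has a non-root
  have hex : ∃ t : ℂ, ¬ (MP.det).IsRoot t := by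
    by_contra hall
    push Not at hall
    apply hMP
    apply Polynomial.eq_zero_of_infinite_isRoot
    have huniv : {x : ℂ | (MP.det).IsRoot x} = Set.univ := Set.eq_univ_of_forall fun x => hall x
    rw [huniv]
    exact Set.infinite_univ
  obtain ⟨t, ht⟩ := hex
  refine ⟨fun b e => Polynomial.eval t (gSc gb b e), fun b e => Polynomial.eval t (dSc db b e), ?_⟩
  have hev : Polynomial.eval t MP.det =
      (Matrix.of fun i j : Fin r => starEntry (fun b e => Polynomial.eval t (gSc gb b e))
        (fun b e => Polynomial.eval t (dSc db b e)) (u i) (w j)).det := by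
    rw [← Polynomial.coe_evalRingHom, RingHom.map_det, RingHom.mapMatrix_apply]
    congr 1; ext i j; simp only [MP, Matrix.map_apply, Matrix.of_apply]; rw [map_starEntry]
  rw [← hev]
  exact ht

end Principle

end StarDoor

end

end Summit.ValiantsHypothesis.ValiantsHypothesis.Theorems.BarrierLever.AnchoredPeeling
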